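import Literature.Analysis.FluidPDE.TaoQuantitativeLowPassBlocks
import Literature.Analysis.FluidPDE.LittlewoodPaleyBlockFn
import Mathlib.MeasureTheory.Function.ConvergenceInMeasure
import HarnessLib

/-!
# Tao 2021, §2: the high-pass projection as a sum of blocks, in `L^q` on a set

Analysis/FluidPDE proof file (theorems only, no named facts), step 8h-2 of the inline programme
for `Literature.Analysis.FluidPDE.tao_quantitative_ess` (Tao 2021, Thm. 1.2).

T. Tao, arXiv:1908.04958v2, §2 p. 7: "`P_{>N}f = ∑_{k=1}^∞ P_{2^kN} f` for Schwartz `f`", used on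
p. 16: "From (3.26) (and the triangle inequality) ... we thus have
`‖P̃_N(P_{>N/100}u ⊗ u)‖ ≲ A³N^{-1}`" — the local `L^{3/2}` norm of the high-pass projection is
bounded by the sum of the local norms of its blocks.

For `u ∈ L²(E; ℝ^ι)` and the low-pass projection `g_κ ⋆ u` this file proves:

* `eLpNorm_indicator_sub_lowPass_le_tsum` — for a measurable `S` and `1 ≤ q`,
  `‖1_S (u − g_κ ⋆ u)‖_q ≤ ∑_{j ∈ ℤ} ‖1_S (Δ̇_j u − Δ̇_j(g_κ ⋆ u))‖_q`
  (the Littlewood–Paley partial sums converge in `L²`, `tendsto_eLpNorm_sub_sum_blockFn`; an a.e.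
  convergent subsequence and Fatou's lemma in `L^q`, `Lp.eLpNorm_lim_le_liminf_eLpNorm`);
* `eLpNorm_indicator_highPass_le_tsum` — with `κ = 2^{m+2}` the terms `j + 1 ≤ m` vanish
  (`blockFn_lowPass_eq_self_euclidean`) and for `m + 2 ≤ j` they are `‖1_S Δ̇_j u‖_q`
  (`blockFn_lowPass_eq_zero_euclidean`).

## References

* T. Tao, arXiv:1908.04958v2 (2021), §2 p. 7 and p. 16. [Tao2021QuantitativeNS]
-/

noncomputable section

open MeasureTheory Set Function Filter Topology
open scoped ENNReal NNReal Convolution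

namespace Literature.Analysis.FluidPDE

open FunctionSpaces Fourier

variable {E : Type*} [NormedAddCommGroup E] [InnerProductSpace ℝ E] [FiniteDimensional ℝ E]
  [MeasurableSpace E] [BorelSpace E]
variable {ι : Type*} [Fintype ι]

/-- **The high-pass projection is dominated by the sum of its blocks, in `L^q` on a set.** For
`u ∈ L²(E; ℝ^ι)`, `κ > 0`, a measurable `S` and `1 ≤ q`:
`‖1_S (u − g_κ ⋆ u)‖_q ≤ ∑_{j ∈ ℤ} ‖1_S (Δ̇_j u − Δ̇_j (g_κ ⋆ u))‖_q`.
[cite: Tao2021QuantitativeNS, §2 p. 7] -/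
theorem eLpNorm_indicator_sub_lowPass_le_tsum [Nontrivial E] {u : E → EuclideanSpace ℝ ι}
    (hu : MemLp u 2 volume) {κ : ℝ} (hκ : 0 < κ) {S : Set E} (hS : MeasurableSet S)
    {q : ℝ≥0∞} (hq : 1 ≤ q) :
    eLpNorm (S.indicator (u - lowPassKernel E κ ⋆[ContinuousLinearMap.lsmul ℝ ℝ, volume] u)) q volume ≤
      ∑' j : ℤ, eLpNorm (S.indicator (blockFn j u -
        blockFn j (lowPassKernel E κ ⋆[ContinuousLinearMap.lsmul ℝ ℝ, volume] u))) q volume := by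
  haveI : Fact (1 ≤ (2 : ℝ≥0∞)) := ⟨one_le_two⟩
  obtain ⟨v, hv⟩ : ∃ v : E → EuclideanSpace ℝ ι,
      v = lowPassKernel E κ ⋆[ContinuousLinearMap.lsmul ℝ ℝ, volume] u := ⟨_, rfl⟩
  rw [← hv]
  have hvL : MemLp v 2 volume := by rw [hv]; exact (memLp_lowPass hκ hu).1
  -- the partial sums and their `L²` convergence
  obtain ⟨P, hP⟩ : ∃ P : ℕ → E → EuclideanSpace ℝ ι,
      P = fun n : ℕ => ∑ j ∈ Finset.Icc (-(n : ℤ)) (n : ℤ), (blockFn j u - blockFn j v) := ⟨_, rfl⟩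
  have hmeas : ∀ j, AEStronglyMeasurable (blockFn j u - blockFn j v) volume := fun j =>
    (aestronglyMeasurable_blockFn j hu.1).sub (aestronglyMeasurable_blockFn j hvL.1)
  have hPm : ∀ n, AEStronglyMeasurable (P n) volume := fun n => by
    rw [hP]; exact Finset.aestronglyMeasurable_sum _ fun j _ => hmeas j
  have hPeq : ∀ n, (u - v) - P n = (u - ∑ j ∈ Finset.Icc (-(n : ℤ)) n, blockFn j u) -
      (v - ∑ j ∈ Finset.Icc (-(n : ℤ)) n, blockFn j v) := fun n => by
    rw [hP]; simp only [Finset.sum_sub_distrib]; abel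
  have hconv : Tendsto (fun n => eLpNorm ((u - v) - P n) 2 volume) atTop (𝓝 0) := by
    have hu' := tendsto_eLpNorm_sub_sum_blockFn (ι := ι) hu
    have hv' := tendsto_eLpNorm_sub_sum_blockFn (ι := ι) hvL
    have hle : ∀ n, eLpNorm ((u - v) - P n) 2 volume ≤
        eLpNorm (u - ∑ j ∈ Finset.Icc (-(n : ℤ)) n, blockFn j u) 2 volume +
          eLpNorm (v - ∑ j ∈ Finset.Icc (-(n : ℤ)) n, blockFn j v) 2 volume := fun n => by
      rw [hPeq n]
      exact eLpNorm_sub_le (hu.1.sub (Finset.aestronglyMeasurable_sum _ fun j _ =>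
        aestronglyMeasurable_blockFn j hu.1)) (hvL.1.sub (Finset.aestronglyMeasurable_sum _ fun j _ =>
        aestronglyMeasurable_blockFn j hvL.1)) one_le_two
    have hsum := hu'.add hv'
    rw [add_zero] at hsum
    exact tendsto_of_tendsto_of_tendsto_of_le_of_le tendsto_const_nhds hsum (fun _ => bot_le) hle
  -- an a.e. convergent subsequence
  have hconv' : Tendsto (fun n => eLpNorm (P n - (u - v)) 2 volume) atTop (𝓝 0) :=
    hconv.congr fun n => by rw [← eLpNorm_neg, neg_sub]
  have hTI := tendstoInMeasure_of_tendsto_eLpNorm two_ne_zero hPm (hu.1.sub hvL.1) hconv'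
  obtain ⟨ns, -, hae⟩ := hTI.exists_seq_tendsto_ae
  -- Fatou in `L^q` for the indicators
  have hae' : ∀ᵐ x ∂volume, Tendsto (fun i => S.indicator (P (ns i)) x) atTop
      (𝓝 (S.indicator (u - v) x)) := by
    filter_upwards [hae] with x hx
    by_cases hxS : x ∈ S
    · simp only [indicator_of_mem hxS]; exact hx
    · simp only [indicator_of_notMem hxS]; exact tendsto_const_nhds
  have hFatou := Lp.eLpNorm_lim_le_liminf_eLpNorm (p := q) (μ := volume)
    (fun i => (hPm (ns i)).indicator hS) (S.indicator (u - v)) hae'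
  refine hFatou.trans (liminf_le_of_frequently_le' (Eventually.of_forall fun i => ?_).frequently)
  -- each partial sum is bounded by the full sum
  rw [hP]
  simp only
  rw [Finset.indicator_sum]
  refine (eLpNorm_sum_le (fun j _ => (hmeas j).indicator hS) hq).trans ?_
  exact ENNReal.sum_le_tsum _

/-- **Tao 2021: the local `L^q` norm of `P_{>}u = u − g_{2^{m+2}} ⋆ u` is at most the sum over
`j ≥ m` of the local norms of its blocks.** For `u ∈ L²(E; ℝ^ι)`, a measurable `S`, `1 ≤ q`:
`‖1_S (u − g_κ ⋆ u)‖_q ≤ ∑_{j ≥ m+2} ‖1_S Δ̇_j u‖_q + ∑_{j ∈ {m, m+1}} ‖1_S (Δ̇_j u − Δ̇_j(g_κ ⋆ u))‖_q`,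
written as one sum over `ℤ` with vanishing terms for `j < m`.
[cite: Tao2021QuantitativeNS, §2 p. 7 and p. 16] -/
theorem eLpNorm_indicator_highPass_le_tsum [Nontrivial E] {u : E → EuclideanSpace ℝ ι}
    (hu : MemLp u 2 volume) (m : ℤ) {S : Set E} (hS : MeasurableSet S) {q : ℝ≥0∞} (hq : 1 ≤ q) :
    eLpNorm (S.indicator (u - lowPassKernel E ((2 : ℝ) ^ (m + 2)) ⋆[ContinuousLinearMap.lsmul ℝ ℝ, volume] u))
        q volume ≤
      ∑' j : ℤ, (Set.Ici m).indicator (fun j =>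
        if m + 2 ≤ j then eLpNorm (S.indicator (blockFn j u)) q volume
        else eLpNorm (S.indicator (blockFn j u -
          blockFn j (lowPassKernel E ((2 : ℝ) ^ (m + 2)) ⋆[ContinuousLinearMap.lsmul ℝ ℝ, volume] u)))
            q volume) j := by
  have hκ : (0 : ℝ) < (2 : ℝ) ^ (m + 2) := zpow_pos two_pos _
  refine (eLpNorm_indicator_sub_lowPass_le_tsum hu hκ hS hq).trans (ENNReal.tsum_le_tsum fun j => ?_)
  by_cases hj : m ≤ j
  · rw [indicator_of_mem (mem_Ici.2 hj)]
    by_cases hj2 : m + 2 ≤ j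
    · rw [if_pos hj2, blockFn_lowPass_eq_zero_euclidean hj2 hu, sub_zero]
    · rw [if_neg hj2]
  · rw [indicator_of_notMem (fun h => hj (mem_Ici.1 h)),
      blockFn_lowPass_eq_self_euclidean (by omega) hu, sub_self]
    simp

end Literature.Analysis.FluidPDE
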